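import Literature.Barriers.QuantumAdvantage.SupremacyTheoremsNonRelativizing
import Literature.Computability.Complexity.PolyTimeCountable
import Literature.Computability.Cryptography.SamplingProblemsCardinality
import HarnessLib

/-!
# `SampBPP^O` is countable for every oracle; the bridge fact `SampPRel_empty` is false

Sibling proof file of `SupremacyTheoremsNonRelativizing.lean` (barrier catalogue
`QuantumAdvantage`; the relativized sampling classes `SampPRel O = SampBPP^O`,
`SampBQPRel A = SampBQP^A` of Aaronson–Chen 2017, Def. 2.3 and §2.2). That file vendors the
"(plausible) model-bridging" named fact

* `SampPRel_empty : SampPRel Oracle.empty = SampP` ("`SampP^∅ = SampP`", used nowhere),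

which is **false over the tree's definitions**, for the reason recorded in
`Literature/Computability/Cryptography/SamplingProblemsCardinality.lean`: the unrelativized
`SampP` of `SamplingProblems.lean` quantifies over `RandAlg`s whose coin budget is only
polynomially *bounded* (advice read off the coin count) and is therefore UNCOUNTABLE
(`not_countable_sampP`), whereas an `OracleAdversary` of `OracleGames.lean` carries LITERAL
polynomials `coins`, `fuel` and a polynomial-time step function, so that `SampPRel O` is a class of
uniform machines and is countable for every oracle `O` — this file's `sampPRel_countable`
(countably many polynomial-time oracle algorithms, `countable_setOf_isPolyTime`; countably many
polynomials; each adversary pins down at most one problem, `PMF.eq_of_forall_tvDist_le_inv`).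
Hence `sampPRel_ne_sampP : SampPRel O ≠ SampP` for EVERY `O`, and the refutation
`not_SampPRel_empty : ¬ SampPRel_empty`.

The plausible bridge is `SampPRel Oracle.empty = UniformSampP` (the uniform class of
`SamplingProblemsUniform.lean`); it is not vendored here (no new named fact in a proof file,
D-0026) but in the sibling `SupremacyTheoremsNonRelativizingSampPRelUniform.lean`, as
`SampPRel_empty_uniform`, PROVED there (`SampPRel_empty_uniform_holds`).

Verdict clean-up (2026-08-16): `SampPRel_empty` can never be discharged (its negation is the theorem
`not_SampPRel_empty` below) and is retired from the named-fact debt as a `@[deprecated]` tombstone in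
`SupremacyTheoremsNonRelativizing.lean`, kept there, statement byte-for-byte, only because this
refutation names it — which is why `linter.deprecated` is switched off for `not_SampPRel_empty` alone.

## Sources

* S. Aaronson, L. Chen, *Complexity-theoretic foundations of quantum supremacy experiments*,
  CCC 2017 (arXiv:1612.05903), Def. 2.3 (p. 12: `SampBPP` by "a probabilistic polynomial-time
  algorithm"; "Oracle versions of these classes can also be defined in the natural way").
* S. Arora, B. Barak, *Computational Complexity: A Modern Approach*, CUP 2009, §1.4 (countably
  many machines), Def. 6.5 (advice).
-/

namespace Literature.Barriers.QuantumAdvantage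

open Literature.Computability.Complexity Literature.Computability.Cryptography

/-- **`SampBPP^O` is countable, for every oracle `O`**: `SampPRel O` is covered by the sets
`{D | ∀ x k, Δ(𝒜^O(⟨x, 1ᵏ⟩), D x) ≤ 1/k}` over the PPT oracle adversaries `𝒜 = (M, coins, fuel)`
— `M` from the countable set of polynomial-time oracle algorithms (`countable_setOf_isPolyTime`),
`coins`, `fuel` from the countable type `Polynomial ℕ` (every polynomial is the sum of its
monomials up to its degree, so `List ℕ` surjects onto it) — each of which has at most one element
(`PMF.eq_of_forall_tvDist_le_inv`). [cite: AroraBarak2009, §1.4] -/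
theorem sampPRel_countable (O : Oracle) : (SampPRel O).Countable := by
  haveI : Countable (Polynomial ℕ) := by
    refine Function.Surjective.countable
      (f := fun l : List ℕ => ∑ i ∈ Finset.range l.length, Polynomial.monomial i (l.getD i 0))
      fun p => ⟨(List.range (p.natDegree + 1)).map p.coeff, ?_⟩
    simp only [List.length_map, List.length_range]
    conv_rhs => rw [p.as_sum_range]
    refine Finset.sum_congr rfl fun i hi => ?_
    rw [List.getD_eq_getElem?_getD, List.getElem?_map,
      List.getElem?_range (Finset.mem_range.1 hi)]
    rfl
  have hA : Set.Countable
      {M : OracleAlg (List Bool) | M.IsPolyTime (_root_.Computability.encodingList Bool)} :=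
    countable_setOf_isPolyTime _
  have hT : ∀ 𝒜 : OracleAdversary (List Bool),
      Set.Subsingleton {D : SamplingProblem | ∀ (x : List Bool) (k : ℕ), 0 < k →
        (PMF.map (fun o => o.getD [])
          (𝒜.outputPMF O (boolPair x (_root_.Computability.unaryEncodeNat k)))).tvDist (D x) ≤
            1 / (k : ℝ)} := by
    intro 𝒜 D hD D' hD'
    funext x
    replace hD := hD x
    replace hD' := hD' x
    exact PMF.eq_of_forall_tvDist_le_inv _ hD hD'
  have hcov : SampPRel O ⊆
      ⋃ M ∈ {M : OracleAlg (List Bool) | M.IsPolyTime (_root_.Computability.encodingList Bool)},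
        ⋃ c : Polynomial ℕ, ⋃ f : Polynomial ℕ,
          {D : SamplingProblem | ∀ (x : List Bool) (k : ℕ), 0 < k →
            (PMF.map (fun o => o.getD []) ((⟨M, c, f⟩ : OracleAdversary (List Bool)).outputPMF O
              (boolPair x (_root_.Computability.unaryEncodeNat k)))).tvDist (D x) ≤
                1 / (k : ℝ)} := by
    rintro D ⟨⟨M, c, f⟩, hM, happrox⟩
    exact Set.mem_biUnion hM (Set.mem_iUnion.2 ⟨c, Set.mem_iUnion.2 ⟨f, happrox⟩⟩)
  exact Set.Countable.mono hcov (hA.biUnion fun M _ => Set.countable_iUnion fun c =>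
    Set.countable_iUnion fun f => (hT ⟨M, c, f⟩).countable)

/-- **`SampBPP^O ≠ SampP` for every oracle `O`** over the tree's definitions: the left side is
countable (`sampPRel_countable`), the advice-taking `SampP` is not (`not_countable_sampP`).
[cite: AroraBarak2009, Def. 6.5 (advice) and §1.4] -/
theorem sampPRel_ne_sampP (O : Oracle) : SampPRel O ≠ SampP := fun h =>
  not_countable_sampP (h ▸ sampPRel_countable O)

-- names the `@[deprecated]` tombstone `SampPRel_empty` of `SupremacyTheoremsNonRelativizing.lean` on
-- purpose: this IS its refutation (verdict clean-up 2026-08-16); REMOVE-WHEN the tombstone is deleted there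
set_option linter.deprecated false in
/-- **Refutation of the vendored named fact `SampPRel_empty`** ("`SampP^∅ = SampP`", a model
bridge recorded as plausible and used nowhere): false as formalised, by `sampPRel_ne_sampP` at
the empty oracle. The plausible bridge equates `SampPRel Oracle.empty` with the UNIFORM class
`UniformSampP` of `SamplingProblemsUniform.lean` — vendored and proved as `SampPRel_empty_uniform` /
`SampPRel_empty_uniform_holds` (`SupremacyTheoremsNonRelativizingSampPRelUniform.lean`); since the
verdict clean-up of 2026-08-16 `SampPRel_empty` itself is a `@[deprecated]` tombstone kept only as the
subject of this theorem. [cite: AaronsonChen2017, Def. 2.3 (p. 12)] -/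
theorem not_SampPRel_empty : ¬ SampPRel_empty :=
  sampPRel_ne_sampP Oracle.empty

end Literature.Barriers.QuantumAdvantage
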